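import Literature.NumberTheory.Automorphic.UnitaryGroupPrincipalSeriesExponents           -- ★ `conjInvChar`, `cmTorusCharPair` (the PAIR currency of the torus)
import Literature.NumberTheory.Automorphic.UnitaryGroupBorelInduction                     -- ★ `normOneUnits`, `mem_normOneUnits_iff`
import Literature.NumberTheory.Automorphic.UnitaryGroupLocalFactors                       -- ★ `continuous_conjLocal`
import Literature.NumberTheory.Automorphic.AnisotropicUnitaryGroupCompactOfPlace          -- ★ `conjLocal_apply_eq_of_smul_eq` (one place above a non-split `v`)
import Literature.NumberTheory.Automorphic.UnitaryGroupNonsplitPlace                      -- ★ `PlacesOver.subsingleton_of_smul_eq`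
import Literature.NumberTheory.Automorphic.AdicCompletionCompact                          -- ★ `compactSpace_adicCompletionIntegers'`
import Literature.NumberTheory.Automorphic.GaloisActionPlaces                             -- ★ `valued_galAdicCompletionMap`
import Literature.NumberTheory.Rogawski1990.CMCharIdentityClauses                         -- ★ organ vocabulary (`Gqs`, …)
import HarnessLib

/-!
# F0 · P3c · line LH6 «StCharTS» — «TOR-DATA★» HAND 1: THE COMPACT PART `M_c = 𝒪ˣ × E¹` OF THE SPLIT TORUS `M = E_vˣ × E¹_v` IN PARAMETER FORM
# [Rogawski1990, §12.2 p. 173; L. 12.7.1 (proof) p. 191; L. 12.7.2 (proof) p. 193]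

Cell `pub/hodgecm-mathlib`, crux H413 = `stmt-HodgeConjecture-24833` (`--supports` lane, helper), route HCCMUnconditional; seat LH6-p01 (g2); DEFAULT organ after
desk F0P3b-plan (g23) 04:40:53Z («the edition that trades (F) for (PSE)(WM)(PSM)(SHF≠0) fires when the torus DATA are CONSTRUCTED concretely»; LH6-p05 (g0) closed
04:42:21Z with «TOR-DATA★» undone).  THEOREMS ONLY, sorry-free, no definition ∕ instance ∕ notation ∕ named fact; every object is an INLINE TERM so that the later
concrete edition of ★ `F0P3cStCharTSSaHead` can bind it by name:
* the torus in parameter form `M := (LocalRing L v)ˣ × ↥(normOneUnits (conjLocal L c v))` (the currency of ★ p849030 ∕ p849140 ∕ p849227);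
* its compact part `M_c := 𝒪_vˣ × E¹_v`, as the TERM `(Submonoid.pi Set.univ (fun w => (w.1.adicCompletionIntegers L).toSubring.toSubmonoid)).units .prod ⊤`
  (the units of the compact open subring `Π_{w∣v} 𝒪_w ⊆ Π_{w∣v} L_w = LocalRing L v`, times all of `E¹_v`);
* the W-reflection `ω = (σ(·)⁻¹, id)` of ★ p849030 (a TERM there already).
WHAT IS PROVED (the (TOR) clauses of ★ p849140 `false_of_saRegroup_disjunct_of_ne_zero` that concern `M_c`, for ANY Borel structure and ANY measure finite on
compacts and positive on opens — e.g. a Haar measure):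
* §1 (generic, any commutative topological ring `R` with `T1`, continuous `σ`): `isClosed_normOneUnits`; `mem_units_pi_iff` (membership in the units of a product
  submonoid is read componentwise on `x` and `x⁻¹`).
* §2 (`LocalRing L v`, any finite `v`): `mem_unitsIntegers_iff` («`u ∈ 𝒪_vˣ` iff `|u_w|_w = 1` for every `w ∣ v`»), `isCompact_unitsIntegers` (Mathlib
  `Submonoid.units_isCompact` on the compact `Π 𝒪_w`, ★ `compactSpace_adicCompletionIntegers'`), `isOpen_unitsIntegers` (`Valued.locally_const`).
* §3 (non-split `v`): `valued_apply_eq_one_of_mem_normOneUnits` («`σ(u)·u = 1 ⇒ |u_w|_w = 1`», one place above `v`: ★ `conjLocal_apply_eq_of_smul_eq` + ★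
  `valued_galAdicCompletionMap`), `normOneUnits_le_unitsIntegers`, `isCompact_normOneUnits` ∕ `compactSpace_normOneUnits` («`E¹_v = U(1)(L⁺_v)` is compact
  at a non-split place»).
* §4 (the compact part): `isCompact_torusCompactPart`, `isOpen_torusCompactPart`, `one_mem`-nonemptiness, hence `measurableSet_torusCompactPart`,
  `measure_torusCompactPart_lt_top`, `measure_real_torusCompactPart_pos` (the four `M_c`-clauses of (TOR)), and `reflect_mem_torusCompactPart`
  («`ω(M_c) ⊆ M_c`», the last (TOR) clause).
NOT HERE (HAND 2): the ray generator `a = (ϖ, 1)` with pairwise disjoint shells `aⁿ·M_c` covering `M`, and `ω` Haar-preserving.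
HONEST LABEL: HC_CM is proved only modulo the 7 printed citations (2 remaining: hLiu418 = stmt-HodgeConjecture-24832, h413 = stmt-HodgeConjecture-24833) until
rung 0 closes; count-neutral (structure lemmas about `E_vˣ × E¹_v`; nothing about characters).

## References
* [Rogawski1990] J. D. Rogawski, *Automorphic Representations of Unitary Groups in Three Variables*, Ann. of Math. Stud. 123 (1990): §1.10 p. 9 (`M = {d(α, β, ᾱ⁻¹)}`,
  `E¹`); §12.2 p. 173 (`M ≅ E* × E¹`, the modulus); §12.7 L. 12.7.1 (proof) p. 191 (`η^m 𝒪_E^*`-shells), L. 12.7.2 (proof) p. 193 (Fourier analysis on `M`).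
* [PlatonovRapinchuk1994] V. Platonov, A. Rapinchuk, *Algebraic Groups and Number Theory* (1994), §5.1 (one place above a non-split `v`; `U(1)` anisotropic ⇒ compact).
-/

set_option autoImplicit false
-- the mandated namespace has the single-problem summit's repeated segment (`HodgeConjecture.HodgeConjecture`)
set_option linter.dupNamespace false

noncomputable section

open NumberField IsDedekindDomain MeasureTheory Topology Filter
open Literature.NumberTheory.Automorphic Literature.NumberTheory.Automorphic.UnitaryGroup

namespace Summit.HodgeConjecture.HodgeConjecture.Cruxes.H413.F0P3cStCharTSTorusCompactPart

/-! ## §1 Generic: `E¹ = ker (x ↦ σ(x)·x)` is closed; units of a product submonoid -/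

/-- **`E¹ = {x ∈ Rˣ : σ(x)·x = 1}` is CLOSED in `Rˣ`** for a continuous ring endomorphism `σ` of a `T₁` topological ring `R` (the preimage of the closed
point `1` under the continuous `x ↦ σ(x)·x`). [cite: Rogawski1990, §1.10 p. 9] -/
theorem isClosed_normOneUnits {R : Type*} [CommRing R] [TopologicalSpace R] [IsTopologicalRing R] [T1Space R] (σ : R →+* R) (hσ : Continuous σ) :
    IsClosed ((normOneUnits σ : Subgroup Rˣ) : Set Rˣ) := by
  have hset : ((normOneUnits σ : Subgroup Rˣ) : Set Rˣ) = (fun x : Rˣ => σ (x : R) * (x : R)) ⁻¹' {1} := by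
    ext x
    rw [SetLike.mem_coe, mem_normOneUnits_iff, Set.mem_preimage, Set.mem_singleton_iff]
  rw [hset]
  exact isClosed_singleton.preimage ((hσ.comp Units.continuous_val).mul Units.continuous_val)

/-- Membership in the units of a product submonoid `Π_i S_i` is read componentwise on `x` and on `x⁻¹`. [folklore] -/
theorem mem_units_pi_iff {ι : Type*} {M : ι → Type*} [∀ i, Monoid (M i)] (S : ∀ i, Submonoid (M i)) (x : (∀ i, M i)ˣ) :
    x ∈ (Submonoid.pi Set.univ S).units ↔ ∀ i, (x : ∀ i, M i) i ∈ S i ∧ ((x⁻¹ : (∀ i, M i)ˣ) : ∀ i, M i) i ∈ S i := by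
  rw [Submonoid.mem_units_iff, Submonoid.mem_pi, Submonoid.mem_pi]
  exact ⟨fun h i => ⟨h.1 i (Set.mem_univ i), h.2 i (Set.mem_univ i)⟩, fun h => ⟨fun i _ => (h i).1, fun i _ => (h i).2⟩⟩

/-! ## §2 `𝒪_vˣ ⊆ (Π_{w∣v} L_w)ˣ`: the units of modulus one at every place, a compact open subgroup -/

section LocalUnits

variable (L : Type) [Field L] [NumberField L] [IsCMField L] (v : HeightOneSpectrum (𝓞 ↥(maximalRealSubfield L)))

omit [IsCMField L] in
/-- **`u ∈ 𝒪_vˣ` iff `|u_w|_w = 1` at every `w ∣ v`** (`𝒪_vˣ` = the units of the product submonoid `Π_{w∣v} 𝒪_w` inside `(Π_{w∣v} L_w)ˣ`: `|u_w| ≤ 1` and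
`|u_w⁻¹| ≤ 1`). [cite: Rogawski1990, §12.2 p. 173] -/
theorem mem_unitsIntegers_iff (u : (LocalRing L v)ˣ) :
    u ∈ (Submonoid.pi Set.univ (fun w : PlacesOver L v => (w.1.adicCompletionIntegers L).toSubring.toSubmonoid)).units ↔
      ∀ w : PlacesOver L v, Valued.v ((u : LocalRing L v) w) = 1 := by
  rw [mem_units_pi_iff]
  refine forall_congr' fun w => ?_
  have hprod : Valued.v (((u⁻¹ : (LocalRing L v)ˣ) : LocalRing L v) w) * Valued.v ((u : LocalRing L v) w) = 1 := by
    rw [← map_mul, ← Pi.mul_apply, Units.inv_mul, Pi.one_apply, map_one]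
  change (u : LocalRing L v) w ∈ w.1.adicCompletionIntegers L ∧ ((u⁻¹ : (LocalRing L v)ˣ) : LocalRing L v) w ∈ w.1.adicCompletionIntegers L ↔ _
  rw [HeightOneSpectrum.mem_adicCompletionIntegers, HeightOneSpectrum.mem_adicCompletionIntegers]
  constructor
  · rintro ⟨h1, h2⟩
    refine le_antisymm h1 ?_
    by_contra hlt
    rw [not_le] at hlt
    have : Valued.v (((u⁻¹ : (LocalRing L v)ˣ) : LocalRing L v) w) * Valued.v ((u : LocalRing L v) w) < 1 := by
      calc Valued.v (((u⁻¹ : (LocalRing L v)ˣ) : LocalRing L v) w) * Valued.v ((u : LocalRing L v) w)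
          ≤ 1 * Valued.v ((u : LocalRing L v) w) := by gcongr
        _ < 1 := by rw [one_mul]; exact hlt
    exact (lt_irrefl (1 : _)) (hprod ▸ this)
  · intro h
    refine ⟨h.le, ?_⟩
    have h2 : Valued.v (((u⁻¹ : (LocalRing L v)ˣ) : LocalRing L v) w) = 1 := by rwa [h, mul_one] at hprod
    exact h2.le

omit [IsCMField L] in
/-- **`𝒪_vˣ` is COMPACT** in `(Π_{w∣v} L_w)ˣ`: the units of the compact submonoid `Π_{w∣v} 𝒪_w` (Mathlib `Submonoid.units_isCompact`; `𝒪_w` compact, ★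
`compactSpace_adicCompletionIntegers'`). [cite: Rogawski1990, §12.2 p. 173] [cite: PlatonovRapinchuk1994, §5.1] -/
theorem isCompact_unitsIntegers :
    IsCompact (((Submonoid.pi Set.univ (fun w : PlacesOver L v => (w.1.adicCompletionIntegers L).toSubring.toSubmonoid)).units :
      Subgroup (LocalRing L v)ˣ) : Set (LocalRing L v)ˣ) := by
  refine Submonoid.units_isCompact ?_
  rw [Submonoid.coe_pi]
  exact isCompact_univ_pi fun w => isCompact_iff_compactSpace.2 (compactSpace_adicCompletionIntegers' L w.1)

omit [IsCMField L] in
/-- **`𝒪_vˣ` is OPEN** in `(Π_{w∣v} L_w)ˣ`: it is the preimage under the (continuous) inclusion `u ↦ (u : Π L_w)` of the product of the unit spheres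
`{|y|_w = 1}`, each open (`Valued.locally_const`). [cite: Rogawski1990, §12.2 p. 173] -/
theorem isOpen_unitsIntegers :
    IsOpen (((Submonoid.pi Set.univ (fun w : PlacesOver L v => (w.1.adicCompletionIntegers L).toSubring.toSubmonoid)).units :
      Subgroup (LocalRing L v)ˣ) : Set (LocalRing L v)ˣ) := by
  have hset : (((Submonoid.pi Set.univ (fun w : PlacesOver L v => (w.1.adicCompletionIntegers L).toSubring.toSubmonoid)).units :
      Subgroup (LocalRing L v)ˣ) : Set (LocalRing L v)ˣ) =
      (fun u : (LocalRing L v)ˣ => (u : LocalRing L v)) ⁻¹' Set.pi Set.univ (fun w : PlacesOver L v => {y : w.1.adicCompletion L | Valued.v y = 1}) := by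
    ext u
    rw [SetLike.mem_coe, mem_unitsIntegers_iff, Set.mem_preimage, Set.mem_univ_pi]
    rfl
  rw [hset]
  refine IsOpen.preimage Units.continuous_val (isOpen_set_pi Set.finite_univ fun w _ => ?_)
  rw [isOpen_iff_mem_nhds]
  intro y hy
  have hy1 : Valued.v y = 1 := hy
  have h := Valued.locally_const (R := w.1.adicCompletion L) (x := y) (by rw [hy1]; exact one_ne_zero)
  rw [hy1] at h
  exact h

end LocalUnits

/-! ## §3 Non-split `v`: `E¹_v ⊆ 𝒪_vˣ`, so `E¹_v` is compact -/

section Nonsplit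

variable (L : Type) [Field L] [NumberField L] [IsCMField L] (v : HeightOneSpectrum (𝓞 ↥(maximalRealSubfield L)))
  (hns : ∀ w : PlacesOver L v, IsCMField.complexConj L • w.1 = w.1)

include hns in
/-- **`σ(u)·u = 1 ⇒ |u_w|_w = 1`** at a NON-SPLIT `v`: one place `w` above `v`, `(σ u)_w = σ_w(u_w)` (★ `conjLocal_apply_eq_of_smul_eq`) and
`|σ_w(·)|_w = |·|_w` (★ `valued_galAdicCompletionMap`), so `|u_w|_w² = 1`. [cite: PlatonovRapinchuk1994, §5.1] [cite: Rogawski1990, §1.10 p. 9] -/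
theorem valued_apply_eq_one_of_mem_normOneUnits {u : (LocalRing L v)ˣ} (hu : u ∈ normOneUnits (conjLocal L (IsCMField.complexConj L) v))
    (w : PlacesOver L v) : Valued.v ((u : LocalRing L v) w) = 1 := by
  have h := (mem_normOneUnits_iff u).1 hu
  have hw := congr_fun h w
  rw [Pi.mul_apply, Pi.one_apply, conjLocal_apply_eq_of_smul_eq (IsCMField.complexConj L) (IsCMField.complexConj_ne_one L) v w (hns w)] at hw
  have hv := congrArg Valued.v hw
  rw [map_mul, valued_galAdicCompletionMap, map_one, ← pow_two] at hv
  exact le_antisymm ((pow_le_one_iff two_ne_zero).1 hv.le) ((one_le_pow_iff two_ne_zero).1 hv.ge)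

include hns in
/-- **`E¹_v ≤ 𝒪_vˣ`** at a non-split `v`. [cite: PlatonovRapinchuk1994, §5.1] -/
theorem normOneUnits_le_unitsIntegers :
    normOneUnits (conjLocal L (IsCMField.complexConj L) v) ≤
      (Submonoid.pi Set.univ (fun w : PlacesOver L v => (w.1.adicCompletionIntegers L).toSubring.toSubmonoid)).units :=
  fun u hu => (mem_unitsIntegers_iff L v u).2 (valued_apply_eq_one_of_mem_normOneUnits L v hns hu)

include hns in
/-- **`E¹_v = U(1)(L⁺_v)` is COMPACT at a non-split `v`** (closed in `(Π L_w)ˣ` and contained in the compact `𝒪_vˣ`). [cite: PlatonovRapinchuk1994, §5.1]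
[cite: Rogawski1990, §1.10 p. 9] -/
theorem isCompact_normOneUnits :
    IsCompact ((normOneUnits (conjLocal L (IsCMField.complexConj L) v) : Subgroup (LocalRing L v)ˣ) : Set (LocalRing L v)ˣ) :=
  (isCompact_unitsIntegers L v).of_isClosed_subset
    (isClosed_normOneUnits _ (continuous_conjLocal L (IsCMField.complexConj L) v))
    (fun _ hu => normOneUnits_le_unitsIntegers L v hns hu)

include hns in
/-- `E¹_v` is a compact SPACE at a non-split `v` (subtype form of `isCompact_normOneUnits`). [cite: PlatonovRapinchuk1994, §5.1] -/
theorem compactSpace_normOneUnits : CompactSpace ↥(normOneUnits (conjLocal L (IsCMField.complexConj L) v)) :=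
  isCompact_iff_compactSpace.1 (isCompact_normOneUnits L v hns)

end Nonsplit

/-! ## §4 The compact part `M_c = 𝒪_vˣ × E¹_v` of `M = E_vˣ × E¹_v`: the (TOR) clauses of ★ p849140 that concern `M_c` -/

section CompactPart

variable (L : Type) [Field L] [NumberField L] [IsCMField L] (v : HeightOneSpectrum (𝓞 ↥(maximalRealSubfield L)))
  (hns : ∀ w : PlacesOver L v, IsCMField.complexConj L • w.1 = w.1)

include hns in
/-- **`M_c = 𝒪_vˣ × E¹_v` is COMPACT** (non-split `v`). [cite: Rogawski1990, §12.7 L. 12.7.2 (proof) p. 193; §12.2 p. 173] -/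
theorem isCompact_torusCompactPart : IsCompact ((((Submonoid.pi Set.univ (fun w : PlacesOver L v => (w.1.adicCompletionIntegers L).toSubring.toSubmonoid)).units.prod (⊤ : Subgroup ↥(normOneUnits (conjLocal L (IsCMField.complexConj L) v)))) : Subgroup ((LocalRing L v)ˣ × ↥(normOneUnits (conjLocal L (IsCMField.complexConj L) v)))) : Set ((LocalRing L v)ˣ × ↥(normOneUnits (conjLocal L (IsCMField.complexConj L) v)))) := by
  haveI := compactSpace_normOneUnits L v hns
  rw [Subgroup.coe_prod, Subgroup.coe_top]
  exact (isCompact_unitsIntegers L v).prod isCompact_univ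

/-- **`M_c` is OPEN** (any finite `v`). [cite: Rogawski1990, §12.7 L. 12.7.2 (proof) p. 193; §12.2 p. 173] -/
theorem isOpen_torusCompactPart : IsOpen ((((Submonoid.pi Set.univ (fun w : PlacesOver L v => (w.1.adicCompletionIntegers L).toSubring.toSubmonoid)).units.prod (⊤ : Subgroup ↥(normOneUnits (conjLocal L (IsCMField.complexConj L) v)))) : Subgroup ((LocalRing L v)ˣ × ↥(normOneUnits (conjLocal L (IsCMField.complexConj L) v)))) : Set ((LocalRing L v)ˣ × ↥(normOneUnits (conjLocal L (IsCMField.complexConj L) v)))) := by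
  rw [Subgroup.coe_prod, Subgroup.coe_top]
  exact (isOpen_unitsIntegers L v).prod isOpen_univ

/-- **`M_c` is MEASURABLE** for any Borel (indeed any opens-measurable) structure on `M`. [cite: Rogawski1990, §12.7 L. 12.7.2 (proof) p. 193] -/
theorem measurableSet_torusCompactPart [MeasurableSpace ((LocalRing L v)ˣ × ↥(normOneUnits (conjLocal L (IsCMField.complexConj L) v)))] [OpensMeasurableSpace ((LocalRing L v)ˣ × ↥(normOneUnits (conjLocal L (IsCMField.complexConj L) v)))] : MeasurableSet ((((Submonoid.pi Set.univ (fun w : PlacesOver L v => (w.1.adicCompletionIntegers L).toSubring.toSubmonoid)).units.prod (⊤ : Subgroup ↥(normOneUnits (conjLocal L (IsCMField.complexConj L) v)))) : Subgroup ((LocalRing L v)ˣ × ↥(normOneUnits (conjLocal L (IsCMField.complexConj L) v)))) : Set ((LocalRing L v)ˣ × ↥(normOneUnits (conjLocal L (IsCMField.complexConj L) v)))) :=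
  (isOpen_torusCompactPart L v).measurableSet

include hns in
/-- **`μ(M_c) < ∞`** for any measure finite on compacts (e.g. a Haar measure on `M`). [cite: Rogawski1990, §12.7 L. 12.7.2 (proof) p. 193] -/
theorem measure_torusCompactPart_lt_top [MeasurableSpace ((LocalRing L v)ˣ × ↥(normOneUnits (conjLocal L (IsCMField.complexConj L) v)))] (μ : Measure ((LocalRing L v)ˣ × ↥(normOneUnits (conjLocal L (IsCMField.complexConj L) v)))) [IsFiniteMeasureOnCompacts μ] : μ ((((Submonoid.pi Set.univ (fun w : PlacesOver L v => (w.1.adicCompletionIntegers L).toSubring.toSubmonoid)).units.prod (⊤ : Subgroup ↥(normOneUnits (conjLocal L (IsCMField.complexConj L) v)))) : Subgroup ((LocalRing L v)ˣ × ↥(normOneUnits (conjLocal L (IsCMField.complexConj L) v)))) : Set ((LocalRing L v)ˣ × ↥(normOneUnits (conjLocal L (IsCMField.complexConj L) v)))) < ⊤ :=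
  (isCompact_torusCompactPart L v hns).measure_lt_top

/-- **`0 < μ(M_c)`** for any measure positive on opens and finite on `M_c` (e.g. a Haar measure on `M`): `M_c` is open and contains `1`.
[cite: Rogawski1990, §12.7 L. 12.7.2 (proof) p. 193] -/
theorem measure_real_torusCompactPart_pos [MeasurableSpace ((LocalRing L v)ˣ × ↥(normOneUnits (conjLocal L (IsCMField.complexConj L) v)))] (μ : Measure ((LocalRing L v)ˣ × ↥(normOneUnits (conjLocal L (IsCMField.complexConj L) v)))) [μ.IsOpenPosMeasure] (hfin : μ ((((Submonoid.pi Set.univ (fun w : PlacesOver L v => (w.1.adicCompletionIntegers L).toSubring.toSubmonoid)).units.prod (⊤ : Subgroup ↥(normOneUnits (conjLocal L (IsCMField.complexConj L) v)))) : Subgroup ((LocalRing L v)ˣ × ↥(normOneUnits (conjLocal L (IsCMField.complexConj L) v)))) : Set ((LocalRing L v)ˣ × ↥(normOneUnits (conjLocal L (IsCMField.complexConj L) v)))) < ⊤) : 0 < μ.real ((((Submonoid.pi Set.univ (fun w : PlacesOver L v => (w.1.adicCompletionIntegers L).toSubring.toSubmonoid)).units.prod (⊤ : Subgroup ↥(normOneUnits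 (conjLocal L (IsCMField.complexConj L) v)))) : Subgroup ((LocalRing L v)ˣ × ↥(normOneUnits (conjLocal L (IsCMField.complexConj L) v)))) : Set ((LocalRing L v)ˣ × ↥(normOneUnits (conjLocal L (IsCMField.complexConj L) v)))) :=
  ENNReal.toReal_pos ((isOpen_torusCompactPart L v).measure_pos μ ⟨1, Subgroup.one_mem _⟩).ne' hfin.ne

include hns in
/-- **`ω(M_c) ⊆ M_c`** for the W-reflection `ω(u, z) = (σ(u)⁻¹, z)` of ★ p849030: `|σ_w(u_w)⁻¹|_w = |u_w|_w⁻¹ = 1` at the one place above the non-split `v`.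
[cite: Rogawski1990, §12.7 L. 12.7.2 (proof) p. 193; §12.2 p. 173] -/
theorem reflect_mem_torusCompactPart :
    ∀ u ∈ ((Submonoid.pi Set.univ (fun w : PlacesOver L v => (w.1.adicCompletionIntegers L).toSubring.toSubmonoid)).units.prod (⊤ : Subgroup ↥(normOneUnits (conjLocal L (IsCMField.complexConj L) v)))),
      ((Units.map ((conjLocal L (IsCMField.complexConj L) v : LocalRing L v →+* LocalRing L v) : LocalRing L v →* LocalRing L v) u.1)⁻¹, u.2) ∈ ((Submonoid.pi Set.univ (fun w : PlacesOver L v => (w.1.adicCompletionIntegers L).toSubring.toSubmonoid)).units.prod (⊤ : Subgroup ↥(normOneUnits (conjLocal L (IsCMField.complexConj L) v)))) := by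
  intro u hu
  rw [Subgroup.mem_prod] at hu ⊢
  refine ⟨?_, Subgroup.mem_top _⟩
  rw [mem_unitsIntegers_iff] at hu ⊢
  intro w
  have h1 := hu.1 w
  -- `|σ(u)_w|_w = 1`
  have hσ : Valued.v (((Units.map ((conjLocal L (IsCMField.complexConj L) v : LocalRing L v →+* LocalRing L v) : LocalRing L v →* LocalRing L v) u.1 :
      (LocalRing L v)ˣ) : LocalRing L v) w) = 1 := by
    rw [Units.coe_map, MonoidHom.coe_coe, conjLocal_apply_eq_of_smul_eq (IsCMField.complexConj L) (IsCMField.complexConj_ne_one L) v w (hns w),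
      valued_galAdicCompletionMap, h1]
  -- the inverse has the inverse valuation
  have hprod : Valued.v ((((Units.map ((conjLocal L (IsCMField.complexConj L) v : LocalRing L v →+* LocalRing L v) : LocalRing L v →* LocalRing L v) u.1)⁻¹ :
      (LocalRing L v)ˣ) : LocalRing L v) w) *
      Valued.v (((Units.map ((conjLocal L (IsCMField.complexConj L) v : LocalRing L v →+* LocalRing L v) : LocalRing L v →* LocalRing L v) u.1 :
      (LocalRing L v)ˣ) : LocalRing L v) w) = 1 := by
    rw [← map_mul, ← Pi.mul_apply, Units.inv_mul, Pi.one_apply, map_one]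
  rwa [hσ, mul_one] at hprod

end CompactPart

end Summit.HodgeConjecture.HodgeConjecture.Cruxes.H413.F0P3cStCharTSTorusCompactPart

end
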